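import Summits.HodgeConjecture.HodgeConjecture.Theorems.F0P3cStCharTSLevelBoxSubgroups   -- ★ p851782 (F0P3-p02): box subgroups + level pieces; brings ★ LevelBoxes p851741 ((L1)(L3)(L4)(L6)(L7)), ★ IwahoriDatum, ★ (J3)
import Summits.HodgeConjecture.HodgeConjecture.Theorems.F0P3cStCharTSAbelianSandwich    -- ★ (J4a) (F0P2-p06): `measure_sandwich_eq`; brings ★ `Literature.MeasureTheory.Group.SubgroupRelIndexMeasure`
import Literature.NumberTheory.Automorphic.GLnCongruenceCommutators                    -- ★ p851695 (L5) (this seat): `commutator_mem_comap_congruenceGL_of_mul_le`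
import Literature.NumberTheory.Automorphic.UnitaryGroupLineBorelRing                   -- ★ `LineRing.isClosed_unipotentU` (`N` is closed in `U′`)
import HarnessLib

/-!
# F0 · P3c · line LH6 «StCharTS» — ROAD «JAC-LOC» brick (J4b) «SANDWICH MEASURE»: `ν(B̄ ⊔ (T_γ ⊔ (B ⊔ K_ε))) = c(s)·c(s_w)·ν(K_γ)` (Harish-Chandra 1970 L. 22; van Dijk 1972 §2)

Cell `pub/hodgecm-mathlib`, crux H413 = `stmt-HodgeConjecture-24833` (lane `--supports … --as helper`); seat LH4-p02 (g8) on the NAME of the road holder LH6-p03 (g5) (F0∕P3b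
15:10:53Z∕15:15:41Z; F0P3-p02 (g21) ceded 15:17:27Z).  MODEL `U′ = U(σ, Φ₃)(K)`, `K` a non-archimedean local field; levels `K_δ := (congruenceGL 3 δ).comap U′.subtype`;
`N`, `N̄ = w₀Nw₀`, `T` of ★ `borelTriple`; boxes `BOX(ρx, ρy) ⊆ N` (★ LevelBoxes).  STATEMENT `measure_sandwich_eq_vanDijk_mul_measure_level`: for REGULAR diagonal `s = diag(d)`
(sizes `α = |a−1|, β = |b−1|`) and `s_w = diag(d ∘ rev)` (sizes `αw, βw`), levels `0 ≠ ε ≤ γ ≤ γ′ < 1`, `γ′γ′ ≤ ε`, `|½|γ′ ≤ 1`, radii `αγ, βγ, αwγ, βwγ ∈ [ε, γ′]`, the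
(J3)∕(J3⁻) depth conditions at `(γ, γ)`, and `B`, `B̄` THE box subgroups `BOX(αγ, βγ)`, `w₀ BOX(αwγ, βwγ) w₀⁻¹`: `ν ↑(B̄ ⊔ ((K_γ ⊓ T) ⊔ (B ⊔ K_ε))) = c(s)·c(s_w)·ν ↑K_γ`
for every left-invariant Borel `ν` on `U′`, `c(·)` = ★ `measure_vanDijk_box`'s constant (the sandwich is ★ (J4c) `inv_mul_conj_mem_sandwich`'s target token for token;
`c(s)·c(s_w) = D(s)` of ★ (J7)).  PROOF: ★ (J4a) `measure_sandwich_eq` twice (`K := K_γ′`, `E := K_ε`; for `P̃` and for `N̄_γ ⊔ ((K_γ ⊓ T) ⊔ (N_γ ⊔ K_ε)) = K_γ`, ★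
`bijOn_iwahori_level`), `hab` by ★ (L5), `hind` by ★ `mem_level_of_nbar_torus_unipotent_mem`; the index ratios `[B : B ∩ K_ε]∕[N_γ : N_ε] = c(s)` read in `N`
(`Subgroup.relIndex_comap`, ★ `measure_subgroup_eq_relIndex_mul_of_isCompact`, ★ (L7) `measure_vanDijk_box`), the `N̄` side carried to `N` by `MulAut.conj w₀`
(`Subgroup.relIndex_map_map_of_injective`; `w₀ K_ε w₀ = K_ε`; `K_γ ∩ N̄ = w₀(K_γ ∩ N)w₀`) and read at `s_w`.  HONEST LABEL: count-neutral bookkeeping for the road «JAC-LOC»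
(hyperbolic half of the print residue «WIF» of the (S-𝔇) organ `stub_EllipticPackage`); closes no organ.  HC_CM is proved only modulo the 7 printed citations (2 remaining:
hLiu418 = `stmt-HodgeConjecture-24832`, h413 = `stmt-HodgeConjecture-24833`) until rung 0 closes.

## References
* [HarishChandra1970] Harish-Chandra, *Harmonic analysis on reductive p-adic groups*, LNM 162 (1970), Lemma 22.
* [vanDijk1972] G. van Dijk, *Computation of certain induced characters of p-adic groups*, Math. Ann. 199 (1972), §2.
* [Rogawski1990] J. D. Rogawski, *Automorphic Representations of Unitary Groups in Three Variables*, Ann. of Math. Stud. 123 (1990), §12.5 p. 182.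
* [Casselman1995] W. Casselman, *Introduction to the theory of admissible representations of p-adic reductive groups* (draft 1995), §1.4 Prop. 1.4.4.
-/

set_option autoImplicit false
-- the mandated namespace has the single-problem summit's repeated segment (`HodgeConjecture.HodgeConjecture`)
set_option linter.dupNamespace false

open Matrix ValuativeRel MeasureTheory
open scoped MatrixGroups NNReal ENNReal Topology
open Literature.NumberTheory.Automorphic Literature.NumberTheory.Automorphic.UnitaryGroup Literature.NumberTheory.Automorphic.UnitaryGroup.HeisRing
open Literature.NumberTheory.Rogawski1990
open Summit.HodgeConjecture.HodgeConjecture.Cruxes.H413.F0P3cStCharTSTorusUnipotentConj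
open Summit.HodgeConjecture.HodgeConjecture.Cruxes.H413.F0P3cStCharTSVanDijkBox
open Summit.HodgeConjecture.HodgeConjecture.Cruxes.H413.F0P3cStCharTSLevelBoxes
open Summit.HodgeConjecture.HodgeConjecture.Cruxes.H413.F0P3cStCharTSLevelBoxSubgroups
open Summit.HodgeConjecture.HodgeConjecture.Cruxes.H413.F0P3cStCharTSAbelianSandwich

namespace Summit.HodgeConjecture.HodgeConjecture.Cruxes.H413.F0P3cStCharTSSandwichMeasure

section Generic

variable {G : Type*} [Group G]

/-- Indices along a subgroup inclusion: `H.relIndex (map K.subtype Y) = (H.comap K.subtype).relIndex Y` (Mathlib `Subgroup.relIndex_comap`). [cite: Casselman1995, §1.4 Prop. 1.4.4] -/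
theorem relIndex_map_subtype_eq (K : Subgroup G) (H : Subgroup G) (Y : Subgroup ↥K) :
    H.relIndex (Y.map K.subtype) = (H.comap K.subtype).relIndex Y :=
  (Subgroup.relIndex_comap H K.subtype Y).symm

/-- A subgroup below `K` is the image of its pull-back to `K`. [cite: Casselman1995, §1.4 Prop. 1.4.4] -/
theorem map_comap_subtype_eq_of_le {K B : Subgroup G} (h : B ≤ K) : (B.comap K.subtype).map K.subtype = B := by
  rw [Subgroup.map_comap_eq, Subgroup.range_subtype, inf_eq_right.2 h]

/-- Cancellation in `ℝ≥0∞`: `i·m = c·(j·m)` with `0 < m < ⊤` gives `i = c·j`. [cite: HarishChandra1970, Lemma 22] -/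
theorem eq_mul_of_mul_eq_mul_mul {i j c m : ℝ≥0∞} (hm0 : m ≠ 0) (hmt : m ≠ ⊤) (h : i * m = c * (j * m)) : i = c * j := by
  rw [← mul_assoc] at h
  exact (ENNReal.mul_left_inj hm0 hmt).1 h

end Generic

section Model

variable {K : Type*} [Field K] [ValuativeRel K] [TopologicalSpace K] [IsNonarchimedeanLocalField K]
  (σ : K →+* K) (hσ : ∀ x, σ (σ x) = x) [Invertible (2 : K)]
  {J : Matrix (Fin 3) (Fin 3) K} (hJ : J = (StdForm.antidiagonal 3).over K)

omit [TopologicalSpace K] [IsNonarchimedeanLocalField K] [Invertible (2 : K)] in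
/-- `w₀ K_δ w₀⁻¹ = K_δ`: the level subgroups are `MulAut.conj w₀`-invariant (★ `weylLongU_mul_mul_weylLongU_mem_comap_congruenceGL`, `w₀⁻¹ = w₀`). [cite: Casselman1995, §1.4 Prop. 1.4.4] -/
theorem map_conj_weylLongU_level_eq (δ : ValueGroupWithZero K) :
    ((congruenceGL 3 δ).comap (unitaryGroupOfForm σ J).subtype).map (MulAut.conj (weylLongU σ hJ)).toMonoidHom =
      (congruenceGL 3 δ).comap (unitaryGroupOfForm σ J).subtype := by
  have hw1 : weylLongU σ hJ * weylLongU σ hJ = 1 := weylLongU_mul_weylLongU σ hJ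
  have hwinv : (weylLongU σ hJ)⁻¹ = weylLongU σ hJ := (eq_inv_of_mul_eq_one_left hw1).symm
  ext x
  constructor
  · intro hx
    obtain ⟨y, hy, rfl⟩ := Subgroup.mem_map.1 hx
    rw [MulEquiv.coe_toMonoidHom, MulAut.conj_apply, hwinv]
    exact weylLongU_mul_mul_weylLongU_mem_comap_congruenceGL σ hJ hy
  · intro hx
    refine Subgroup.mem_map.2 ⟨weylLongU σ hJ * x * weylLongU σ hJ, weylLongU_mul_mul_weylLongU_mem_comap_congruenceGL σ hJ hx, ?_⟩
    rw [MulEquiv.coe_toMonoidHom, MulAut.conj_apply, hwinv]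
    simp only [← mul_assoc, hw1, one_mul]
    rw [mul_assoc, hw1, mul_one]

omit [TopologicalSpace K] [IsNonarchimedeanLocalField K] [Invertible (2 : K)] in
/-- `K_γ ∩ N̄ = w₀ (K_γ ∩ N) w₀⁻¹` as subgroups (★ `mem_level_inf_Nbar_iff`). [cite: Casselman1995, §1.4 Prop. 1.4.4] -/
theorem level_inf_Nbar_eq_map (γ : ValueGroupWithZero K) :
    (congruenceGL 3 γ).comap (unitaryGroupOfForm σ J).subtype ⊓ ((borelTriple σ J hJ).N).map (MulAut.conj (weylLongU σ hJ)).toMonoidHom =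
      ((congruenceGL 3 γ).comap (unitaryGroupOfForm σ J).subtype ⊓ (borelTriple σ J hJ).N).map (MulAut.conj (weylLongU σ hJ)).toMonoidHom := by
  have hw1 : weylLongU σ hJ * weylLongU σ hJ = 1 := weylLongU_mul_weylLongU σ hJ
  have hwinv : (weylLongU σ hJ)⁻¹ = weylLongU σ hJ := (eq_inv_of_mul_eq_one_left hw1).symm
  ext x
  rw [mem_level_inf_Nbar_iff σ hJ, Subgroup.mem_map]
  constructor
  · rintro ⟨n, hn, rfl⟩
    exact ⟨n, hn, by rw [MulEquiv.coe_toMonoidHom, MulAut.conj_apply, hwinv]⟩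
  · rintro ⟨n, hn, rfl⟩
    exact ⟨n, hn, by rw [MulEquiv.coe_toMonoidHom, MulAut.conj_apply, hwinv]⟩

omit [TopologicalSpace K] [IsNonarchimedeanLocalField K] [Invertible (2 : K)] in
/-- Intersections with a `w₀`-invariant level commute with `MulAut.conj w₀`: `K_δ ⊓ X.map(conj w₀) = (K_δ ⊓ X).map(conj w₀)`. [cite: Casselman1995, §1.4 Prop. 1.4.4] -/
theorem level_inf_map_conj_eq (δ : ValueGroupWithZero K) (X : Subgroup ↥(unitaryGroupOfForm σ J)) :
    (congruenceGL 3 δ).comap (unitaryGroupOfForm σ J).subtype ⊓ X.map (MulAut.conj (weylLongU σ hJ)).toMonoidHom =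
      ((congruenceGL 3 δ).comap (unitaryGroupOfForm σ J).subtype ⊓ X).map (MulAut.conj (weylLongU σ hJ)).toMonoidHom := by
  have hinj : Function.Injective (MulAut.conj (weylLongU σ hJ)).toMonoidHom := (MulAut.conj (weylLongU σ hJ)).injective
  rw [Subgroup.map_inf _ _ _ hinj, map_conj_weylLongU_level_eq σ hJ δ]

omit [TopologicalSpace K] [IsNonarchimedeanLocalField K] [Invertible (2 : K)] in
/-- **THE SANDWICH AT LEVEL `γ` IS THE WHOLE LEVEL**: `N̄_γ ⊔ ((K_γ ⊓ T) ⊔ (N_γ ⊔ K_ε)) = K_γ` for `ε ≤ γ < 1` (★ `bijOn_iwahori_level`). [cite: Casselman1995, §1.4 Prop. 1.4.4] -/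
theorem nbar_sup_torus_sup_unipotent_sup_level_eq {γ ε : ValueGroupWithZero K} (hγ : γ < 1) (hεγ : ε ≤ γ) :
    ((congruenceGL 3 γ).comap (unitaryGroupOfForm σ J).subtype ⊓ ((borelTriple σ J hJ).N).map (MulAut.conj (weylLongU σ hJ)).toMonoidHom) ⊔
      ((((congruenceGL 3 γ).comap (unitaryGroupOfForm σ J).subtype) ⊓ torusU σ J) ⊔
        (((congruenceGL 3 γ).comap (unitaryGroupOfForm σ J).subtype ⊓ (borelTriple σ J hJ).N) ⊔
          (congruenceGL 3 ε).comap (unitaryGroupOfForm σ J).subtype)) =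
      (congruenceGL 3 γ).comap (unitaryGroupOfForm σ J).subtype := by
  have hεK : (congruenceGL 3 ε).comap (unitaryGroupOfForm σ J).subtype ≤ (congruenceGL 3 γ).comap (unitaryGroupOfForm σ J).subtype :=
    Subgroup.comap_mono (congruenceGL_mono hεγ)
  apply le_antisymm
  · exact sup_le inf_le_left (sup_le inf_le_left (sup_le inf_le_left hεK))
  · intro k hk
    obtain ⟨⟨x, y, z⟩, ⟨hx, hy, hz⟩, hxyz⟩ := (bijOn_iwahori_level σ hJ hγ).surjOn hk
    simp only at hxyz
    rw [← hxyz]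
    refine Subgroup.mul_mem _ (Subgroup.mul_mem _ (Subgroup.mem_sup_left hx) (Subgroup.mem_sup_right (Subgroup.mem_sup_left ?_)))
      (Subgroup.mem_sup_right (Subgroup.mem_sup_right (Subgroup.mem_sup_left hz)))
    rw [borelTriple_M] at hy
    exact hy

end Model

section Head

variable {K : Type*} [Field K] [ValuativeRel K] [TopologicalSpace K] [IsNonarchimedeanLocalField K]
  [IsTopologicalRing K] [T2Space K] [SecondCountableTopology K] [MeasurableSpace K] [BorelSpace K]
  (σ : K →+* K) (hσ : ∀ x, σ (σ x) = x) (hσc : Continuous σ) [Invertible (2 : K)]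
  {J : Matrix (Fin 3) (Fin 3) K} (hJ : J = (StdForm.antidiagonal 3).over K)
  (hσv : ∀ x, valuation K (σ x) = valuation K x)
  [MeasurableSpace ↥(unitaryGroupOfForm σ J)] [BorelSpace ↥(unitaryGroupOfForm σ J)]
  [MeasurableSpace ↥(unipotentU σ J)] [BorelSpace ↥(unipotentU σ J)]

include hσ hσc hJ hσv in
/-- **(J4b) THE SANDWICH MEASURE** (module docstring): `ν ↑P̃ = c(s)·c(s_w) · ν ↑K_γ`, `P̃ = B̄ ⊔ ((K_γ ⊓ T) ⊔ (B ⊔ K_ε))` = ★ (J4c)'s target; `c(·)` = ★ `measure_vanDijk_box`'s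
constant at `s` resp. `s_w` (only `hdw : diag(d ∘ rev) = s_w` is read); `μN` only mediates the index ratios. [cite: HarishChandra1970, Lemma 22] [cite: vanDijk1972, §2]
[cite: Rogawski1990, §12.5 p. 182] [cite: Casselman1995, §1.4 Prop. 1.4.4] -/
theorem measure_sandwich_eq_vanDijk_mul_measure_level
    (ν : Measure ↥(unitaryGroupOfForm σ J)) [ν.IsMulLeftInvariant]
    (μN : Measure ↥(unipotentU σ J)) [μN.IsHaarMeasure]
    (s sw : ↥(torusU σ J)) {d : Fin 3 → Kˣ}
    (hd : glDiagonal 3 K d = ((s : ↥(unitaryGroupOfForm σ J)) : GL (Fin 3) K))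
    (hdw : glDiagonal 3 K (d ∘ Fin.rev) = ((sw : ↥(unitaryGroupOfForm σ J)) : GL (Fin 3) K))
    (hreg : IsRegularElt ((s : ↥(unitaryGroupOfForm σ J)) : GL (Fin 3) K))
    (hregw : IsRegularElt ((sw : ↥(unitaryGroupOfForm σ J)) : GL (Fin 3) K))
    {γ γ' ε : ValueGroupWithZero K} (hε0 : ε ≠ 0) (hεγ : ε ≤ γ) (hγγ' : γ ≤ γ') (hγ'1 : γ' < 1) (hab : γ' * γ' ≤ ε)
    (h2γ' : valuation K (⅟(2 : K)) * γ' ≤ 1)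
    -- the four radii lie in the window `[ε, γ′]`
    (ha : valuation K ((((d 0)⁻¹ * d 1 : Kˣ) : K) - 1) * γ ≤ γ') (hb : valuation K ((((d 0)⁻¹ * d 2 : Kˣ) : K) - 1) * γ ≤ γ')
    (haw : valuation K ((((d 2)⁻¹ * d 1 : Kˣ) : K) - 1) * γ ≤ γ') (hbw : valuation K ((((d 2)⁻¹ * d 0 : Kˣ) : K) - 1) * γ ≤ γ')
    (hεa : ε ≤ valuation K ((((d 0)⁻¹ * d 1 : Kˣ) : K) - 1) * γ) (hεb : ε ≤ valuation K ((((d 0)⁻¹ * d 2 : Kˣ) : K) - 1) * γ)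
    (hεaw : ε ≤ valuation K ((((d 2)⁻¹ * d 1 : Kˣ) : K) - 1) * γ) (hεbw : ε ≤ valuation K ((((d 2)⁻¹ * d 0 : Kˣ) : K) - 1) * γ)
    -- the (J3)∕(J3⁻) depth conditions at radii `(γ, γ)` (★ (J4c) `hρ`, `hρw` verbatim)
    (hρ : valuation K (⅟(2 : K)) * valuation K ((((d 0)⁻¹ * d 1 : Kˣ) : K) - σ (((d 0)⁻¹ * d 1 : Kˣ) : K)) * (γ * γ) ≤
      valuation K ((((d 0)⁻¹ * d 2 : Kˣ) : K) - 1) * γ)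
    (hρw : valuation K (⅟(2 : K)) * valuation K ((((d 2)⁻¹ * d 1 : Kˣ) : K) - σ (((d 2)⁻¹ * d 1 : Kˣ) : K)) * (γ * γ) ≤
      valuation K ((((d 2)⁻¹ * d 0 : Kˣ) : K) - 1) * γ)
    -- THE box subgroups
    (B Bbar : Subgroup ↥(unitaryGroupOfForm σ J))
    (hB : (B : Set ↥(unitaryGroupOfForm σ J)) = (fun n : ↥(unipotentU σ J) => (n : ↥(unitaryGroupOfForm σ J))) ''
      {n | valuation K (heisX σ n) ≤ valuation K ((((d 0)⁻¹ * d 1 : Kˣ) : K) - 1) * γ ∧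
        valuation K (heisY σ hσ hJ n : K) ≤ valuation K ((((d 0)⁻¹ * d 2 : Kˣ) : K) - 1) * γ})
    (hBbar : (Bbar : Set ↥(unitaryGroupOfForm σ J)) =
      (fun n : ↥(unipotentU σ J) => weylLongU σ hJ * (n : ↥(unitaryGroupOfForm σ J)) * (weylLongU σ hJ)⁻¹) ''
        {n | valuation K (heisX σ n) ≤ valuation K ((((d 2)⁻¹ * d 1 : Kˣ) : K) - 1) * γ ∧
          valuation K (heisY σ hσ hJ n : K) ≤ valuation K ((((d 2)⁻¹ * d 0 : Kˣ) : K) - 1) * γ}) :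
    ν ((Bbar ⊔ ((((congruenceGL 3 γ).comap (unitaryGroupOfForm σ J).subtype) ⊓ torusU σ J) ⊔
        (B ⊔ (congruenceGL 3 ε).comap (unitaryGroupOfForm σ J).subtype)) : Subgroup ↥(unitaryGroupOfForm σ J)) : Set ↥(unitaryGroupOfForm σ J)) =
      ((distribHaarChar K (isUnit_rootA_sub_one σ s hd hreg).unit *
          skewModulus σ hσc (isUnit_rootB_sub_one σ s hd hreg).unit
            (map_unit_torusCentralScalar_sub_one σ hJ s hd (isUnit_rootB_sub_one σ s hd hreg)) : ℝ≥0) : ℝ≥0∞) *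
      ((distribHaarChar K (isUnit_rootA_sub_one σ sw hdw hregw).unit *
          skewModulus σ hσc (isUnit_rootB_sub_one σ sw hdw hregw).unit
            (map_unit_torusCentralScalar_sub_one σ hJ sw hdw (isUnit_rootB_sub_one σ sw hdw hregw)) : ℝ≥0) : ℝ≥0∞) *
      ν (((congruenceGL 3 γ).comap (unitaryGroupOfForm σ J).subtype : Subgroup ↥(unitaryGroupOfForm σ J)) : Set ↥(unitaryGroupOfForm σ J)) := by
  classical
  set Kγ : Subgroup ↥(unitaryGroupOfForm σ J) := (congruenceGL 3 γ).comap (unitaryGroupOfForm σ J).subtype with hKγ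
  set Kγ' : Subgroup ↥(unitaryGroupOfForm σ J) := (congruenceGL 3 γ').comap (unitaryGroupOfForm σ J).subtype with hKγ'
  set Kε : Subgroup ↥(unitaryGroupOfForm σ J) := (congruenceGL 3 ε).comap (unitaryGroupOfForm σ J).subtype with hKε
  set ι : ↥(unipotentU σ J) →* ↥(unitaryGroupOfForm σ J) := (unipotentU σ J).subtype with hι
  set cw : ↥(unitaryGroupOfForm σ J) →* ↥(unitaryGroupOfForm σ J) := (MulAut.conj (weylLongU σ hJ)).toMonoidHom with hcw
  set a : Kˣ := (d 0)⁻¹ * d 1 with ha_def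
  set b : Kˣ := (d 0)⁻¹ * d 2 with hb_def
  set aw : Kˣ := (d 2)⁻¹ * d 1 with haw_def
  set bw : Kˣ := (d 2)⁻¹ * d 0 with hbw_def
  have hεγ' : ε ≤ γ' := hεγ.trans hγγ'
  have hε1 : ε < 1 := lt_of_le_of_lt hεγ' hγ'1
  have hγ1 : γ < 1 := lt_of_le_of_lt hγγ' hγ'1
  have hγ0 : γ ≠ 0 := fun h => hε0 (le_zero_iff.1 (h ▸ hεγ))
  have hγ'0 : γ' ≠ 0 := fun h => hε0 (le_zero_iff.1 (h ▸ hεγ'))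
  have h2γ : valuation K (⅟(2 : K)) * γ ≤ 1 := (mul_le_mul_right hγγ' _).trans h2γ'
  have h2ε : valuation K (⅟(2 : K)) * ε ≤ 1 := (mul_le_mul_right hεγ' _).trans h2γ'
  have hεK' : Kε ≤ Kγ' := Subgroup.comap_mono (congruenceGL_mono hεγ')
  have hγK' : Kγ ≤ Kγ' := Subgroup.comap_mono (congruenceGL_mono hγγ')
  have hεKγ : Kε ≤ Kγ := Subgroup.comap_mono (congruenceGL_mono hεγ)
  have hcwinj : Function.Injective cw := (MulAut.conj (weylLongU σ hJ)).injective
  have hcwsurj : Function.Surjective cw := (MulAut.conj (weylLongU σ hJ)).surjective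
  have hL1 : ∀ {δ : ValueGroupWithZero K}, δ < 1 → valuation K (⅟(2 : K)) * δ ≤ 1 → ∀ n : ↥(unipotentU σ J),
      (n : ↥(unitaryGroupOfForm σ J)) ∈ (congruenceGL 3 δ).comap (unitaryGroupOfForm σ J).subtype ↔
        valuation K (heisX σ n) ≤ δ ∧ valuation K (heisY σ hσ hJ n : K) ≤ δ :=
    fun hδ h2 n => mem_level_iff_of_mem_unipotentU σ hσ hJ hσv hδ h2 n
  have hBN : B ≤ unipotentU σ J := by
    intro x hx; rw [← SetLike.mem_coe, hB] at hx; obtain ⟨n, -, rfl⟩ := hx; exact n.2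
  set Hb : Subgroup ↥(unipotentU σ J) := B.comap ι with hHb
  have hHbmem : ∀ n : ↥(unipotentU σ J), n ∈ Hb ↔
      valuation K (heisX σ n) ≤ valuation K ((a : K) - 1) * γ ∧ valuation K (heisY σ hσ hJ n : K) ≤ valuation K ((b : K) - 1) * γ := fun n => by
    rw [hHb, Subgroup.mem_comap, hι, Subgroup.coe_subtype]
    exact coe_mem_iff_of_coe_eq_image σ hB n
  have hBmap : Hb.map ι = B := by rw [hHb, hι]; exact map_comap_subtype_eq_of_le hBN
  set BwU : Subgroup ↥(unitaryGroupOfForm σ J) := Bbar.comap cw with hBwU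
  have hBwUcoe : (BwU : Set ↥(unitaryGroupOfForm σ J)) = (fun n : ↥(unipotentU σ J) => (n : ↥(unitaryGroupOfForm σ J))) ''
      {n | valuation K (heisX σ n) ≤ valuation K ((aw : K) - 1) * γ ∧ valuation K (heisY σ hσ hJ n : K) ≤ valuation K ((bw : K) - 1) * γ} := by
    ext x
    rw [SetLike.mem_coe, hBwU, Subgroup.mem_comap, ← SetLike.mem_coe, hBbar, Set.mem_image, Set.mem_image]
    simp only [hcw, MulEquiv.coe_toMonoidHom, MulAut.conj_apply, Set.mem_setOf_eq]
    constructor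
    · rintro ⟨n, hn, h⟩
      exact ⟨n, hn, by simpa [mul_assoc] using congr_arg (fun y => (weylLongU σ hJ)⁻¹ * y * weylLongU σ hJ) h⟩
    · rintro ⟨n, hn, rfl⟩; exact ⟨n, hn, rfl⟩
  have hBbar_eq : Bbar = BwU.map cw := by rw [hBwU, Subgroup.map_comap_eq_self_of_surjective hcwsurj]
  have hBwUN : BwU ≤ unipotentU σ J := by
    intro x hx; rw [← SetLike.mem_coe, hBwUcoe] at hx; obtain ⟨n, -, rfl⟩ := hx; exact n.2
  set Hbw : Subgroup ↥(unipotentU σ J) := BwU.comap ι with hHbw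
  have hHbwmem : ∀ n : ↥(unipotentU σ J), n ∈ Hbw ↔
      valuation K (heisX σ n) ≤ valuation K ((aw : K) - 1) * γ ∧ valuation K (heisY σ hσ hJ n : K) ≤ valuation K ((bw : K) - 1) * γ := fun n => by
    rw [hHbw, Subgroup.mem_comap, hι, Subgroup.coe_subtype]
    exact coe_mem_iff_of_coe_eq_image σ hBwUcoe n
  have hBwUmap : Hbw.map ι = BwU := by rw [hHbw, hι]; exact map_comap_subtype_eq_of_le hBwUN
  have hHKmem : ∀ {δ : ValueGroupWithZero K}, δ < 1 → valuation K (⅟(2 : K)) * δ ≤ 1 → ∀ n : ↥(unipotentU σ J),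
      n ∈ ((congruenceGL 3 δ).comap (unitaryGroupOfForm σ J).subtype).comap ι ↔
        valuation K (heisX σ n) ≤ δ ∧ valuation K (heisY σ hσ hJ n : K) ≤ δ := fun hδ h2 n => by
    rw [Subgroup.mem_comap, hι, Subgroup.coe_subtype]
    exact hL1 hδ h2 n
  have hKNmap : ∀ δ : ValueGroupWithZero K, (((congruenceGL 3 δ).comap (unitaryGroupOfForm σ J).subtype).comap ι).map ι =
      (congruenceGL 3 δ).comap (unitaryGroupOfForm σ J).subtype ⊓ (borelTriple σ J hJ).N := fun δ => by
    rw [hι, Subgroup.map_comap_eq, Subgroup.range_subtype, inf_comm, borelTriple_N]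
  have hKεHb : Kε.comap ι ≤ Hb := fun n hn => by
    obtain ⟨hx, hy⟩ := (hHKmem hε1 h2ε n).1 hn
    exact (hHbmem n).2 ⟨hx.trans hεa, hy.trans hεb⟩
  have hKεHbw : Kε.comap ι ≤ Hbw := fun n hn => by
    obtain ⟨hx, hy⟩ := (hHKmem hε1 h2ε n).1 hn
    exact (hHbwmem n).2 ⟨hx.trans hεaw, hy.trans hεbw⟩
  have hKεKγN : Kε.comap ι ≤ Kγ.comap ι := Subgroup.comap_mono hεKγ
  have hHbK' : Hb ≤ Kγ'.comap ι := fun n hn => by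
    obtain ⟨hx, hy⟩ := (hHbmem n).1 hn
    exact (hHKmem hγ'1 h2γ' n).2 ⟨hx.trans ha, hy.trans hb⟩
  have hHbwK' : Hbw ≤ Kγ'.comap ι := fun n hn => by
    obtain ⟨hx, hy⟩ := (hHbwmem n).1 hn
    exact (hHKmem hγ'1 h2γ' n).2 ⟨hx.trans haw, hy.trans hbw⟩
  have hiB : Kε.relIndex B = (Kε.comap ι).relIndex Hb := by rw [← hBmap, hι, relIndex_map_subtype_eq]
  have hjN : Kε.relIndex (Kγ ⊓ (borelTriple σ J hJ).N) = (Kε.comap ι).relIndex (Kγ.comap ι) := by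
    rw [← hKNmap γ, hι, relIndex_map_subtype_eq]
  have hiBw : Kε.relIndex Bbar = (Kε.comap ι).relIndex Hbw := by
    have e1 : Kε.relIndex Bbar = (Kε.map cw).relIndex (BwU.map cw) := by
      rw [hBbar_eq, hKε, hcw, map_conj_weylLongU_level_eq σ hJ ε]
    rw [e1, Subgroup.relIndex_map_map_of_injective _ _ hcwinj, ← hBwUmap, hι, relIndex_map_subtype_eq]
  have hjNw : Kε.relIndex (Kγ ⊓ ((borelTriple σ J hJ).N).map cw) = (Kε.comap ι).relIndex (Kγ.comap ι) := by
    have e1 : Kε.relIndex (Kγ ⊓ ((borelTriple σ J hJ).N).map cw) = (Kε.map cw).relIndex ((Kγ ⊓ (borelTriple σ J hJ).N).map cw) := by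
      rw [hKγ, hKε, hcw, level_inf_Nbar_eq_map σ hJ γ, map_conj_weylLongU_level_eq σ hJ ε]
    rw [e1, Subgroup.relIndex_map_map_of_injective _ _ hcwinj, hjN]
  have hNcl : IsClosed (unipotentU σ J : Set ↥(unitaryGroupOfForm σ J)) := LineRing.isClosed_unipotentU σ J
  have hemb : Topology.IsClosedEmbedding (fun n : ↥(unipotentU σ J) => (n : ↥(unitaryGroupOfForm σ J))) := hNcl.isClosedEmbedding_subtypeVal
  obtain ⟨hKγ'c, -⟩ := isCompact_isOpen_comap_congruenceGL σ (J := J) hσc hγ'0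
  obtain ⟨hKγc, -⟩ := isCompact_isOpen_comap_congruenceGL σ (J := J) hσc hγ0
  obtain ⟨-, hKεo⟩ := isCompact_isOpen_comap_congruenceGL σ (J := J) hσc hε0
  have hcoe_comap : ∀ X : Subgroup ↥(unitaryGroupOfForm σ J), ((X.comap ι : Subgroup ↥(unipotentU σ J)) : Set ↥(unipotentU σ J)) =
      (fun n : ↥(unipotentU σ J) => (n : ↥(unitaryGroupOfForm σ J))) ⁻¹' (X : Set ↥(unitaryGroupOfForm σ J)) := fun X => by
    rw [hι]; rfl
  have hKγ'cN : IsCompact ((Kγ'.comap ι : Subgroup ↥(unipotentU σ J)) : Set ↥(unipotentU σ J)) := by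
    rw [hcoe_comap]; exact hemb.isCompact_preimage hKγ'c
  have hKγcN : IsCompact ((Kγ.comap ι : Subgroup ↥(unipotentU σ J)) : Set ↥(unipotentU σ J)) := by
    rw [hcoe_comap]; exact hemb.isCompact_preimage hKγc
  have hKεoN : IsOpen ((Kε.comap ι : Subgroup ↥(unipotentU σ J)) : Set ↥(unipotentU σ J)) := by
    rw [hcoe_comap]; exact hKεo.preimage continuous_subtype_val
  have hboxset : ∀ rx ry : ValueGroupWithZero K,
      {n : ↥(unipotentU σ J) | valuation K (heisX σ n) ≤ rx ∧ valuation K (heisY σ hσ hJ n : K) ≤ ry} =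
        (fun n => heisX σ n) ⁻¹' {x : K | valuation K x ≤ rx} ∩ (fun n => (heisY σ hσ hJ n : K)) ⁻¹' {x : K | valuation K x ≤ ry} :=
    fun rx ry => by ext n; simp only [Set.mem_setOf_eq, Set.mem_inter_iff, Set.mem_preimage]
  have hcontX : Continuous fun n : ↥(unipotentU σ J) => heisX σ n := continuous_heisX σ
  have hcontY : Continuous fun n : ↥(unipotentU σ J) => (heisY σ hσ hJ n : K) := continuous_subtype_val.comp (continuous_heisY σ hσ hσc hJ)
  have hbox_open : ∀ {rx ry : ValueGroupWithZero K}, rx ≠ 0 → ry ≠ 0 →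
      IsOpen {n : ↥(unipotentU σ J) | valuation K (heisX σ n) ≤ rx ∧ valuation K (heisY σ hσ hJ n : K) ≤ ry} := fun hx hy => by
    rw [hboxset]
    exact ((DeltaCharBorel.isOpen_setOf_valuation_le hx).preimage hcontX).inter ((DeltaCharBorel.isOpen_setOf_valuation_le hy).preimage hcontY)
  have hbox_closed : ∀ rx ry : ValueGroupWithZero K,
      IsClosed {n : ↥(unipotentU σ J) | valuation K (heisX σ n) ≤ rx ∧ valuation K (heisY σ hσ hJ n : K) ≤ ry} := fun rx ry => by
    rw [hboxset]
    exact ((isClosed_setOf_valuation_le rx).preimage hcontX).inter ((isClosed_setOf_valuation_le ry).preimage hcontY)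
  have hva0 : valuation K ((a : K) - 1) ≠ 0 := (Valuation.ne_zero_iff _).2 (isUnit_rootA_sub_one σ s hd hreg).ne_zero
  have hvb0 : valuation K ((b : K) - 1) ≠ 0 := (Valuation.ne_zero_iff _).2 (isUnit_rootB_sub_one σ s hd hreg).ne_zero
  have hrev0 : (d ∘ Fin.rev) 0 = d 2 := by simp [Function.comp_apply]
  have hrev1 : (d ∘ Fin.rev) 1 = d 1 := by simp [Function.comp_apply]
  have hrev2 : (d ∘ Fin.rev) 2 = d 0 := by simp [Function.comp_apply]
  have hvaw0 : valuation K ((aw : K) - 1) ≠ 0 := by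
    have h := (isUnit_rootA_sub_one σ sw hdw hregw).ne_zero
    rw [hrev0, hrev1] at h
    exact (Valuation.ne_zero_iff _).2 h
  have hvbw0 : valuation K ((bw : K) - 1) ≠ 0 := by
    have h := (isUnit_rootB_sub_one σ sw hdw hregw).ne_zero
    rw [hrev0, hrev2] at h
    exact (Valuation.ne_zero_iff _).2 h
  have hHbcoe : (Hb : Set ↥(unipotentU σ J)) =
      {n | valuation K (heisX σ n) ≤ valuation K ((a : K) - 1) * γ ∧ valuation K (heisY σ hσ hJ n : K) ≤ valuation K ((b : K) - 1) * γ} :=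
    Set.ext fun n => by rw [SetLike.mem_coe, hHbmem n, Set.mem_setOf_eq]
  have hHbwcoe : (Hbw : Set ↥(unipotentU σ J)) =
      {n | valuation K (heisX σ n) ≤ valuation K ((aw : K) - 1) * γ ∧ valuation K (heisY σ hσ hJ n : K) ≤ valuation K ((bw : K) - 1) * γ} :=
    Set.ext fun n => by rw [SetLike.mem_coe, hHbwmem n, Set.mem_setOf_eq]
  have hKγNcoe : ((Kγ.comap ι : Subgroup ↥(unipotentU σ J)) : Set ↥(unipotentU σ J)) =
      {n | valuation K (heisX σ n) ≤ γ ∧ valuation K (heisY σ hσ hJ n : K) ≤ γ} :=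
    Set.ext fun n => by rw [SetLike.mem_coe, hHKmem hγ1 h2γ n, Set.mem_setOf_eq]
  have hHbo : IsOpen (Hb : Set ↥(unipotentU σ J)) := by rw [hHbcoe]; exact hbox_open (mul_ne_zero hva0 hγ0) (mul_ne_zero hvb0 hγ0)
  have hHbwo : IsOpen (Hbw : Set ↥(unipotentU σ J)) := by rw [hHbwcoe]; exact hbox_open (mul_ne_zero hvaw0 hγ0) (mul_ne_zero hvbw0 hγ0)
  have hKγNo : IsOpen ((Kγ.comap ι : Subgroup ↥(unipotentU σ J)) : Set ↥(unipotentU σ J)) := by rw [hKγNcoe]; exact hbox_open hγ0 hγ0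
  have hHbc : IsCompact (Hb : Set ↥(unipotentU σ J)) :=
    hKγ'cN.of_isClosed_subset (by rw [hHbcoe]; exact hbox_closed _ _) (fun n hn => hHbK' hn)
  have hHbwc : IsCompact (Hbw : Set ↥(unipotentU σ J)) :=
    hKγ'cN.of_isClosed_subset (by rw [hHbwcoe]; exact hbox_closed _ _) (fun n hn => hHbwK' hn)
  obtain ⟨-, hmB⟩ := Literature.MeasureTheory.Group.measure_subgroup_eq_relIndex_mul_of_isCompact μN hKεHb hHbc hHbo hKεoN
  obtain ⟨-, hmBw⟩ := Literature.MeasureTheory.Group.measure_subgroup_eq_relIndex_mul_of_isCompact μN hKεHbw hHbwc hHbwo hKεoN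
  obtain ⟨-, hmγ⟩ := Literature.MeasureTheory.Group.measure_subgroup_eq_relIndex_mul_of_isCompact μN hKεKγN hKγcN hKγNo hKεoN
  have hball : ∀ r : ValueGroupWithZero K, IsClosed {x : K | valuation K x ≤ r} := fun r => isClosed_setOf_valuation_le r
  have hvD := measure_vanDijk_box σ hσ hσc hJ (valuation K) hσv μN s hd hreg (ρx := γ) (ρy := γ) hρ
    (measurableSet_box σ hσ hσc hJ (valuation K) hball _ _)
  have hρw' : valuation K (⅟(2 : K)) * valuation K (((((d ∘ Fin.rev) 0)⁻¹ * (d ∘ Fin.rev) 1 : Kˣ) : K) - σ ((((d ∘ Fin.rev) 0)⁻¹ * (d ∘ Fin.rev) 1 : Kˣ) : K)) * (γ * γ) ≤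
      valuation K (((((d ∘ Fin.rev) 0)⁻¹ * (d ∘ Fin.rev) 2 : Kˣ) : K) - 1) * γ := by
    rw [hrev0, hrev1, hrev2]; exact hρw
  have hvDw := measure_vanDijk_box σ hσ hσc hJ (valuation K) hσv μN sw hdw hregw (ρx := γ) (ρy := γ) hρw'
    (measurableSet_box σ hσ hσc hJ (valuation K) hball _ _)
  rw [← hHbcoe, ← hKγNcoe] at hvD
  have hboxw_eq : {n : ↥(unipotentU σ J) | valuation K (heisX σ n) ≤ valuation K (((((d ∘ Fin.rev) 0)⁻¹ * (d ∘ Fin.rev) 1 : Kˣ) : K) - 1) * γ ∧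
      valuation K (heisY σ hσ hJ n : K) ≤ valuation K (((((d ∘ Fin.rev) 0)⁻¹ * (d ∘ Fin.rev) 2 : Kˣ) : K) - 1) * γ} = (Hbw : Set ↥(unipotentU σ J)) := by
    rw [hHbwcoe, hrev0, hrev1, hrev2]
  rw [hboxw_eq, ← hKγNcoe] at hvDw
  have hm0 : μN ((Kε.comap ι : Subgroup ↥(unipotentU σ J)) : Set ↥(unipotentU σ J)) ≠ 0 :=
    hKεoN.measure_ne_zero μN ⟨1, Subgroup.one_mem _⟩
  have hmt : μN ((Kε.comap ι : Subgroup ↥(unipotentU σ J)) : Set ↥(unipotentU σ J)) ≠ ⊤ :=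
    (lt_of_le_of_lt (measure_mono (fun n hn => hKεKγN hn)) hKγcN.measure_lt_top).ne
  have hratio : ((Kε.relIndex B : ℕ) : ℝ≥0∞) =
      ((distribHaarChar K (isUnit_rootA_sub_one σ s hd hreg).unit *
          skewModulus σ hσc (isUnit_rootB_sub_one σ s hd hreg).unit
            (map_unit_torusCentralScalar_sub_one σ hJ s hd (isUnit_rootB_sub_one σ s hd hreg)) : ℝ≥0) : ℝ≥0∞) *
        ((Kε.relIndex (Kγ ⊓ (borelTriple σ J hJ).N) : ℕ) : ℝ≥0∞) := by
    rw [hiB, hjN]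
    refine eq_mul_of_mul_eq_mul_mul hm0 hmt ?_
    rw [← hmB, hvD, hmγ]
  have hratiow : ((Kε.relIndex Bbar : ℕ) : ℝ≥0∞) =
      ((distribHaarChar K (isUnit_rootA_sub_one σ sw hdw hregw).unit *
          skewModulus σ hσc (isUnit_rootB_sub_one σ sw hdw hregw).unit
            (map_unit_torusCentralScalar_sub_one σ hJ sw hdw (isUnit_rootB_sub_one σ sw hdw hregw)) : ℝ≥0) : ℝ≥0∞) *
        ((Kε.relIndex (Kγ ⊓ ((borelTriple σ J hJ).N).map cw) : ℕ) : ℝ≥0∞) := by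
    rw [hiBw, hjNw]
    refine eq_mul_of_mul_eq_mul_mul hm0 hmt ?_
    rw [← hmBw, hvDw, hmγ]
  have hab' : ∀ x ∈ Kγ', ∀ y ∈ Kγ', x * y * x⁻¹ * y⁻¹ ∈ Kε := fun x hx y hy =>
    commutator_mem_comap_congruenceGL_of_mul_le (unitaryGroupOfForm σ J).subtype hab hx hy
  have hBK' : B ≤ Kγ' := by rw [← hBmap]; exact Subgroup.map_le_iff_le_comap.2 hHbK'
  have hBwUK' : BwU ≤ Kγ' := by rw [← hBwUmap]; exact Subgroup.map_le_iff_le_comap.2 hHbwK'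
  have hBbarK' : Bbar ≤ Kγ' := by
    rw [hBbar_eq, hKγ', hcw, ← map_conj_weylLongU_level_eq σ hJ γ']
    exact Subgroup.map_mono hBwUK'
  have hCK' : Kγ ⊓ torusU σ J ≤ Kγ' := inf_le_left.trans hγK'
  have hNγK' : Kγ ⊓ (borelTriple σ J hJ).N ≤ Kγ' := inf_le_left.trans hγK'
  have hNwγK' : Kγ ⊓ ((borelTriple σ J hJ).N).map cw ≤ Kγ' := inf_le_left.trans hγK'
  have hBbarNw : Bbar ≤ ((borelTriple σ J hJ).N).map cw := by
    rw [hBbar_eq, borelTriple_N]; exact Subgroup.map_mono hBwUN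
  have hind : ∀ (X Y : Subgroup ↥(unitaryGroupOfForm σ J)), X ≤ ((borelTriple σ J hJ).N).map cw → Y ≤ (borelTriple σ J hJ).N →
      ∀ bbar ∈ X, ∀ c ∈ Kγ ⊓ torusU σ J, ∀ b' ∈ Y, bbar * c * b' ∈ Kε → bbar ∈ Kε ∧ c ∈ Kε ∧ b' ∈ Kε := by
    intro X Y hX hY bbar hbbar c hc b' hb' hk
    have hcM : c ∈ (borelTriple σ J hJ).M := by rw [borelTriple_M]; exact (Subgroup.mem_inf.1 hc).2
    exact mem_level_of_nbar_torus_unipotent_mem σ hJ hε1 (hX hbbar) hcM (hY hb') hk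
  obtain ⟨-, hS1⟩ := measure_sandwich_eq (K := Kγ') (E := Kε) (Bbar := Bbar) (C := Kγ ⊓ torusU σ J) (B := B) ν hεK' hab' hBbarK' hCK' hBK'
    (hind Bbar B hBbarNw (by rw [borelTriple_N]; exact hBN)) hKγ'c hKεo
  obtain ⟨-, hS2⟩ := measure_sandwich_eq (K := Kγ') (E := Kε) (Bbar := Kγ ⊓ ((borelTriple σ J hJ).N).map cw) (C := Kγ ⊓ torusU σ J)
    (B := Kγ ⊓ (borelTriple σ J hJ).N) ν hεK' hab' hNwγK' hCK' hNγK' (hind _ _ inf_le_right inf_le_right) hKγ'c hKεo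
  have hK2 : (Kγ ⊓ ((borelTriple σ J hJ).N).map cw) ⊔ ((Kγ ⊓ torusU σ J) ⊔ ((Kγ ⊓ (borelTriple σ J hJ).N) ⊔ Kε)) = Kγ := by
    rw [hKγ, hKε, hcw]; exact nbar_sup_torus_sup_unipotent_sup_level_eq σ hJ hγ1 hεγ
  rw [hK2] at hS2
  rw [hS1, hS2, Nat.cast_mul, Nat.cast_mul, Nat.cast_mul, Nat.cast_mul, hratio, hratiow]
  ring

end Head

end Summit.HodgeConjecture.HodgeConjecture.Cruxes.H413.F0P3cStCharTSSandwichMeasure
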